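/-
Literature file (hubbard-downfold / hubbard-eph front-ends): paramagnon (spin-fluctuation) suppression of the
electron–phonon `T_c` — the Stoner enhancement factor, the Daams–Mitrović–Carbotte rescaling and the extended
McMillan formula, with the monotonicity facts a parameter box needs.
-/
import Literature.MathematicalPhysics.QuantumManyBody.McMillanAllenDynes

/-!
# Paramagnon suppression of the electron–phonon `T_c`

Nearly magnetic metals (Pd, V, Nb, VN, the Ni-rich intermetallics, …) have a large exchange-enhanced spin
susceptibility; the associated ferromagnetic spin correlations («paramagnons») oppose singlet pairing and lower
the phonon-mediated transition temperature (Berk–Schrieffer 1966, Doniach–Engelsberg 1966; reviewed in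
Wolf 1985, §4.5.3). Screening pipelines for the conventional branch of this programme's material oracle meet
this physics in two places: the ROUTER reads the Stoner product `x = N(0)·I` of a d-metal (moment legs,
«spin-fluctuation honesty tests»), and the electron–phonon branch pre-registers «spin fluctuations unboxed ⇒
harmonic `T_c` too high» for V, Nb, VN, Pd-class rows and, where it quotes a number, a `λ_sf`. This file
vendors the three printed formulas involved as real-valued DEFINITIONS and proves the elementary order facts
through which they are used. All inputs are plain real parameters; nothing is asserted about any material or
about the accuracy of the formulas relative to the Eliashberg equations.

* The STONER ENHANCEMENT FACTOR `S = 1 / (1 − N(0) I)` of the spin susceptibility, `χ = S · χ_P`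
  (Wolf 1985 Eq. (4.36); Mohn 2006 §8.2 Eq. (8.21), criterion (8.22) `N(0) I > 1` for the ferromagnetic
  instability — in Mohn's units the product reads `2 μ_B² I_s 𝒩(ε_F)`): `stonerFactor x = 1/(1 − x)` with
  `x` the dimensionless Stoner product. Proved: `S = 1 + x S` (the RPA geometric series as a fixed-point
  identity), `1 + x ≤ S`, strict monotonicity on `x < 1`, divergence at `x → 1⁻` in the quantitative form
  `B < S(x)` for `1 − 1/B < x < 1`, the sign form of the Stoner criterion (`S < 0 ↔ 1 < x`), and the
  inversion `x = 1 − 1/S`.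
* The SPIN-FLUCTUATION COUPLING from the Stoner product, `λ_sf = α · x · ln(1/(1 − x))` with a constant
  `α` of order one, and the characteristic paramagnon frequency `ω_sf ≈ c (1 − x)/x · p_F v_F`
  (Bose–Dolgov–Kortus–Jepsen–Andersen 2003, Eqs. (10)–(11)): `lambdaSF`, `omegaSF`; proved nonnegativity,
  `λ_sf = α x ln S`, monotonicity of `λ_sf` and antitonicity of `ω_sf` in `x` on `[0, 1)`, `ω_sf(1) = 0`.
* The DAAMS–MITROVIĆ–CARBOTTE RESCALING: with paramagnon spectral weight `λ_S`, the low-energy Eliashberg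
  problem is simulated by `α²F_e = α²F_ph/(1 + λ_S)`, `λ_e = λ_ph/(1 + λ_S)`,
  `μ*_e ≃ (μ*_ph + λ_S)/(1 + λ_S)` (Daams, Mitrović, Carbotte 1981, restated as Wolf 1985
  Eqs. (4.38)–(4.40)): `dmcLambda`, `dmcMuStar`, and the McMillan `T_c` evaluated at the rescaled pair,
  `dmcTc ω λ μ* λ_S = mcMillanTc ω (λ/(1+λ_S)) ((μ*+λ_S)/(1+λ_S))`. Proved: the identities
  `1 + λ_e = (1 + λ + λ_S)/(1 + λ_S)` and `λ_e − μ*_e = (λ − μ* − λ_S)/(1 + λ_S)` (the familiar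
  «`1 + λ + λ_S` over `λ − μ* − λ_S`» effective exponent), the exact McMillan exponent at the rescaled pair,
  `λ_e ≤ λ`, `μ* ≤ μ*_e < 1` (for `μ* < 1`), monotonicity of both maps in `λ_S`, and — by composing with
  the monotonicity theorems of `McMillanAllenDynes.lean` — `dmcTc ≤ mcMillanTc` and antitonicity of `dmcTc`
  in `λ_S` on the physical domain.
* The EXTENDED MCMILLAN FORMULA with paramagnons (`ω_sf ≫ ω_ph`),
  `T_c = (ω_ln/1.2) · exp{−1.04 (1 + λ_ph + λ_sf) / (λ_ph − λ_sf − μ*[1 + 0.62 (λ_ph + λ_sf)])}`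
  (Bose et al. 2003 Eq. (12)): `sfDenom`, `sfExponent`, `sfTc`. Proved: reduction to `mcMillanTc` at
  `λ_sf = 0`; `T_c` antitone — strictly, for `ω > 0` — in `λ_sf`, monotone in `λ_ph` and in `ω`, antitone in
  `μ*`; the box → band corner rule in `(ω, λ_ph, μ*, λ_sf)`; `sfTc ≤ mcMillanTc`.
* ORDERING OF THE TWO PRINTED CONVENTIONS: at equal `(ω, λ, μ*, λ_S)` the DMC-rescaled McMillan value lies
  BELOW the extended-McMillan value exactly when `μ*(1 + λ + λ_S) ≤ λ` (`sfDenom_sub_dmcDenom`,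
  `dmcTc_le_sfTc`), so in that regime `dmcTc ≤ sfTc ≤ mcMillanTc`: a pipeline that does not choose between
  the conventions carries the interval `[dmcTc, sfTc]`, never an average.
* FITTING `λ_sf` TO A MEASURED `T_c` (the step by which Rietschel–Winter-type analyses extract `λ_sf` for
  V, Nb, VN from `T_c^{exp}` below the phonon-only value): at fixed `(ω, λ, μ*)` in the physical domain the map
  `λ_sf ↦ sfTc` is injective on its domain (`sfTc_injOn`) and attains EVERY value in `(0, T_c^{McM}]`
  (`exists_lamSF_sfTc_eq`, intermediate value theorem) — the fitted `λ_sf` exists and is unique.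

* `DFT+U` AS AN EFFECTIVE STONER RENORMALISATION (Petukhov–Mazin–Chioncel–Lichtenstein 2003, as used by
  Smolyanyuk–Mazin–Garcia-Gassull–Valentí 2024 §II.B for RuO₂): «in the first approximation DFT+U (in its SIC
  flavor …) is equivalent to renormalizing the DFT Stoner parameter as `I_eff = I₀ + (U − J)/n`, where `I₀` is
  the DFT Stoner parameter and `n` is number of orbitals at the Fermi level»: `stonerIeff I₀ U_eff n`, the
  `+U` needed to cross the Stoner instability `stonerUcrit D I₀ n = n (1/D − I₀)` (`one_lt_mul_stonerIeff_iff`),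
  its sign (`stonerUcrit_pos_iff`: a metal stable at `U = 0` needs a POSITIVE `U_eff` to order), monotonicity
  in `U_eff` and in `n`, and the printed RuO₂ arithmetic as decidable corollaries (`D↑(E_F) = 0.7` st/(eV·spin),
  `I₀ ∼ 0.5` eV ⇒ `D·I₀ = 0.35 < 1`; at `U_eff = 1.4` eV, `n = 1` ⇒ `I_eff ≈ 1.9`, criterion met; `n = 2` just
  below; the printed `DFT+U` onset of the compensated moment, `U_eff ∈ [1.06, 1.23]` eV, lies strictly between
  the `n = 1` and `n = 2` thresholds `13/14` and `13/7` eV). Inputs only; nothing is asserted about RuO₂ itself.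

Physical domain used in the hypotheses: `0 ≤ ω`, `0 ≤ λ`, `0 ≤ μ*` (and `μ* ≤ 1` where the DMC `μ*_e` must
stay a pseudopotential), `0.62 μ* ≤ 1`, `0 ≤ λ_S`, and positivity of the relevant denominator at the worst
corner. Outside it the definitions take Lean's junk values (`x/0 = 0`) and no theorem speaks about them.

Deliberately NOT here: the paramagnon spectral function `P(ω)` and `λ_S` as its moment (Wolf Eq. (4.38),
Bose Eq. (9)) — `λ_S` enters as a number; the broad-spectrum correction Bose Eq. (13); any claim that a given
material has a given `x`, `λ_sf` or `α`.

## References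
* [BerkSchrieffer1966] N. F. Berk, J. R. Schrieffer, *Effect of ferromagnetic spin correlations on
  superconductivity*, Phys. Rev. Lett. 17 (1966) 433–435.
* [DaamsMitrovicCarbotte1981] J. M. Daams, B. Mitrović, J. P. Carbotte, *Simulation of the effects of
  paramagnons on a superconductor by a simple rescaling*, Phys. Rev. Lett. 46 (1981) 65–68.
* [Wolf1985] E. L. Wolf, *Principles of Electron Tunneling Spectroscopy*, Oxford UP (1985), §4.5.3
  «Spin fluctuations», Eqs. (4.33)–(4.40) (Stoner factor (4.36); `λ_S` (4.38); rescaling (4.39)–(4.40)).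
* [BoseEtAl2003] S. K. Bose, O. V. Dolgov, J. Kortus, O. Jepsen, O. K. Andersen, *Pressure dependence of
  electron–phonon coupling and superconductivity in hcp Fe: a linear response study*, Phys. Rev. B 67 (2003)
  214518, Eqs. (10)–(12).
* [Mohn2006] P. Mohn, *Magnetism in the Solid State*, 2nd ed., Springer (2006), §8.2 Eqs. (8.21)–(8.22),
  Table 8.1.
* [AllenDynes1975] P. B. Allen, R. C. Dynes, Phys. Rev. B 12 (1975) 905, Eq. (34) (the McMillan form used).
* [PetukhovEtAl2003] A. G. Petukhov, I. I. Mazin, L. Chioncel, A. I. Lichtenstein, *Correlated metals and the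
  LDA+U method*, Phys. Rev. B 67 (2003) 153106 (the `I_eff = I₀ + (U − J)/n` reading of `+U`).
* [SmolyanyukEtAl2024] A. Smolyanyuk, I. I. Mazin, L. Garcia-Gassull, R. Valentí, *Fragility of the magnetic
  order in the prototypical altermagnet RuO₂*, Phys. Rev. B 109 (2024) 134424, §II.B (arXiv:2310.06909 p. 4:
  «I_eff = I₀ + (U − J)/n … D↑(E_F) = 0.7 (st/eV·spin), thus D↑(E_F)·I₀ = 0.35 < 1 … for U_eff = 1.4 eV we get
  I_eff ≈ 1.9 eV, thus fulfilling the Stoner criterion; for n = 2 it is just a bit below instability»; §II.A: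
  onset `U_eff ∼ 1.06` eV (metastable) / `1.23` eV (ground state)).
-/

noncomputable section

namespace Literature.MathematicalPhysics.QuantumManyBody

namespace Paramagnon

/-! ## The Stoner enhancement factor -/

/-- The **Stoner enhancement factor** `S(x) = 1 / (1 − x)` of the uniform spin susceptibility of an
interacting itinerant electron system, `χ = S · χ_Pauli`, as a function of the dimensionless Stoner product
`x = N(0)·I` (density of states at the Fermi level per spin times the Stoner exchange integral; in Mohn's
units `x = 2 μ_B² I_s 𝒩(ε_F)`). Meaningful for `x < 1` (paramagnetic side); `x > 1` is the Stoner criterion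
for the ferromagnetic instability. [cite: Wolf1985, §4.5.3 Eq. (4.36)] [cite: Mohn2006, §8.2 Eq. (8.21)] -/
def stonerFactor (x : ℝ) : ℝ := 1 / (1 - x)

/-- No exchange enhancement without exchange: `S(0) = 1`. [cite: Mohn2006, §8.2 Eq. (8.21)] -/
theorem stonerFactor_zero : stonerFactor 0 = 1 := by
  simp [stonerFactor]

/-- On the paramagnetic side `x < 1` the enhancement factor is positive. [cite: Mohn2006, §8.2 Eq. (8.21)] -/
theorem stonerFactor_pos {x : ℝ} (hx : x < 1) : 0 < stonerFactor x := by
  unfold stonerFactor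
  exact div_pos one_pos (by linarith)

/-- The RPA fixed-point identity `S = 1 + x·S` (`χ = χ_P + I N(0) χ`, the geometric series of bubble
diagrams summed). [cite: Mohn2006, §8.2 Eq. (8.21)] -/
theorem stonerFactor_eq_one_add_mul {x : ℝ} (hx : x < 1) : stonerFactor x = 1 + x * stonerFactor x := by
  unfold stonerFactor
  have h1 : (1 - x) ≠ 0 := by linarith
  field_simp
  ring

/-- `S ≥ 1` for a repulsive exchange `0 ≤ x < 1`: the interacting susceptibility is ENHANCED over the Pauli
value. [cite: Mohn2006, §8.2 Eq. (8.21)] -/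
theorem one_le_stonerFactor {x : ℝ} (hx0 : 0 ≤ x) (hx : x < 1) : 1 ≤ stonerFactor x := by
  unfold stonerFactor
  rw [le_div_iff₀ (by linarith)]
  linarith

/-- `S > 1` for `0 < x < 1`. [cite: Mohn2006, §8.2 Eq. (8.21)] -/
theorem one_lt_stonerFactor {x : ℝ} (hx0 : 0 < x) (hx : x < 1) : 1 < stonerFactor x := by
  unfold stonerFactor
  rw [lt_div_iff₀ (by linarith)]
  linarith

/-- First-order lower bound `1 + x ≤ S(x)` for every `x < 1` (`(1 + x)(1 − x) = 1 − x² ≤ 1`: the first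
bubble already under-estimates the full geometric series). [cite: Mohn2006, §8.2 Eq. (8.21)] -/
theorem one_add_le_stonerFactor {x : ℝ} (hx : x < 1) : 1 + x ≤ stonerFactor x := by
  unfold stonerFactor
  rw [le_div_iff₀ (by linarith)]
  nlinarith [sq_nonneg x]

/-- The enhancement factor is strictly increasing in the Stoner product on the paramagnetic side `x < 1`.
[cite: Mohn2006, §8.2 Eq. (8.21)] -/
theorem stonerFactor_strictMonoOn : StrictMonoOn stonerFactor (Set.Iio 1) := by
  intro a ha b hb hab
  simp only [Set.mem_Iio] at ha hb
  unfold stonerFactor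
  exact one_div_lt_one_div_of_lt (by linarith) (by linarith)

/-- Monotone form of `stonerFactor_strictMonoOn`. [cite: Mohn2006, §8.2 Eq. (8.21)] -/
theorem stonerFactor_le_stonerFactor {a b : ℝ} (hab : a ≤ b) (hb : b < 1) :
    stonerFactor a ≤ stonerFactor b := by
  unfold stonerFactor
  exact one_div_le_one_div_of_le (by linarith) (by linarith)

/-- **Divergence at the instability, quantitative form**: for every bound `B > 0` the enhancement exceeds `B`
as soon as the Stoner product is within `1/B` of the critical value, `1 − 1/B < x < 1`.
[cite: Mohn2006, §8.2 Eqs. (8.21)–(8.22)] -/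
theorem lt_stonerFactor_of_lt {B x : ℝ} (hB : 0 < B) (hx : x < 1) (hBx : 1 - 1 / B < x) :
    B < stonerFactor x := by
  unfold stonerFactor
  rw [lt_div_iff₀ (by linarith)]
  have h1 : 1 - x < 1 / B := by linarith
  calc B * (1 - x) < B * (1 / B) := by exact mul_lt_mul_of_pos_left h1 hB
    _ = 1 := by field_simp

/-- The enhancement factor is unbounded on `[0, 1)`: no finite `S` is «the largest paramagnetic enhancement».
[cite: Mohn2006, §8.2 Eqs. (8.21)–(8.22)] -/
theorem stonerFactor_unbounded (B : ℝ) : ∃ x : ℝ, 0 ≤ x ∧ x < 1 ∧ B < stonerFactor x := by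
  by_cases hB : B < 1
  · exact ⟨0, le_refl 0, zero_lt_one, by rw [stonerFactor_zero]; exact hB⟩
  · rw [not_lt] at hB
    have hBpos : 0 < B := lt_of_lt_of_le zero_lt_one hB
    refine ⟨1 - 1 / (2 * B), ?_, ?_, ?_⟩
    · have : 1 / (2 * B) ≤ 1 := by
        rw [div_le_one (by positivity)]
        linarith
      linarith
    · have : 0 < 1 / (2 * B) := by positivity
      linarith
    · apply lt_stonerFactor_of_lt hBpos
      · have : 0 < 1 / (2 * B) := by positivity
        linarith
      · have h2 : 1 / (2 * B) < 1 / B := by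
          apply one_div_lt_one_div_of_lt hBpos
          linarith
        linarith

/-- **The Stoner criterion in sign form**: away from the pole, the RPA susceptibility factor is negative exactly
when the Stoner product exceeds one (`N(0) I > 1`: the paramagnetic state is not a minimum of the free energy
and the metal orders ferromagnetically). [cite: Mohn2006, §8.2 Eq. (8.22)] -/
theorem stonerFactor_neg_iff {x : ℝ} (hx : x ≠ 1) : stonerFactor x < 0 ↔ 1 < x := by
  unfold stonerFactor
  have h1 : 1 - x ≠ 0 := sub_ne_zero.2 (Ne.symm hx)
  constructor
  · intro h
    by_contra hle
    rw [not_lt] at hle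
    have : 0 ≤ 1 / (1 - x) := div_nonneg zero_le_one (by linarith)
    linarith
  · intro h
    exact div_neg_of_pos_of_neg one_pos (by linarith)

/-- **Inversion**: the Stoner product from a (measured or computed) enhancement, `x = 1 − 1/S` (`x < 1`).
[cite: Mohn2006, §8.2 Eq. (8.21)] -/
theorem eq_one_sub_inv_stonerFactor {x : ℝ} (hx : x < 1) : x = 1 - 1 / stonerFactor x := by
  unfold stonerFactor
  have h1 : (1 - x) ≠ 0 := by linarith
  field_simp
  ring

/-- The inversion map `S ↦ 1 − 1/S` is monotone on `S > 0`: a larger measured enhancement certifies a larger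
Stoner product. [cite: Mohn2006, §8.2 Eq. (8.21)] -/
theorem one_sub_inv_mono {S₁ S₂ : ℝ} (hS₁ : 0 < S₁) (h : S₁ ≤ S₂) : 1 - 1 / S₁ ≤ 1 - 1 / S₂ := by
  have := one_div_le_one_div_of_le hS₁ h
  linarith

/-! ## The spin-fluctuation coupling constant and paramagnon frequency from the Stoner product -/

/-- The **spin-fluctuation (paramagnon) mass-enhancement constant** obtained by integrating the paramagnon
spectral function of a uniform enhanced electron gas, `λ_sf = α · N(0) I · ln[1/(1 − N(0) I)]`, with `α`
«of order unity» (treated by Bose et al. as a fitting parameter for a transition metal); here as a function of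
`α` and the Stoner product `x = N(0) I`. [cite: BoseEtAl2003, Eq. (10)] -/
def lambdaSF (α x : ℝ) : ℝ := α * x * Real.log (1 / (1 - x))

/-- `λ_sf` vanishes without exchange enhancement. [cite: BoseEtAl2003, Eq. (10)] -/
theorem lambdaSF_zero (α : ℝ) : lambdaSF α 0 = 0 := by
  simp [lambdaSF]

/-- `λ_sf = α · x · ln S(x)`: the logarithm in Bose et al.'s Eq. (10) is the logarithm of the Stoner factor.
[cite: BoseEtAl2003, Eq. (10)] [cite: Wolf1985, §4.5.3 Eq. (4.36)] -/
theorem lambdaSF_eq_mul_log_stonerFactor (α x : ℝ) :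
    lambdaSF α x = α * x * Real.log (stonerFactor x) := rfl

/-- `λ_sf ≥ 0` on the paramagnetic side `0 ≤ x < 1` for `α ≥ 0`. [cite: BoseEtAl2003, Eq. (10)] -/
theorem lambdaSF_nonneg {α x : ℝ} (hα : 0 ≤ α) (hx0 : 0 ≤ x) (hx : x < 1) : 0 ≤ lambdaSF α x := by
  unfold lambdaSF
  have hlog : 0 ≤ Real.log (1 / (1 - x)) := Real.log_nonneg (one_le_stonerFactor hx0 hx)
  have : 0 ≤ α * x := mul_nonneg hα hx0
  exact mul_nonneg this hlog

/-- `λ_sf > 0` for `α > 0` and `0 < x < 1`. [cite: BoseEtAl2003, Eq. (10)] -/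
theorem lambdaSF_pos {α x : ℝ} (hα : 0 < α) (hx0 : 0 < x) (hx : x < 1) : 0 < lambdaSF α x := by
  unfold lambdaSF
  have hlog : 0 < Real.log (1 / (1 - x)) := Real.log_pos (one_lt_stonerFactor hx0 hx)
  have : 0 < α * x := mul_pos hα hx0
  exact mul_pos this hlog

/-- `λ_sf` is monotone increasing in the Stoner product on `[0, 1)` (for `α ≥ 0`): a more strongly enhanced
metal carries a larger pair-breaking coupling. [cite: BoseEtAl2003, Eq. (10)] -/
theorem lambdaSF_monotoneOn {α : ℝ} (hα : 0 ≤ α) : MonotoneOn (lambdaSF α) (Set.Ico 0 1) := by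
  intro a ha b hb hab
  simp only [Set.mem_Ico] at ha hb
  unfold lambdaSF
  have hSa : 1 ≤ 1 / (1 - a) := one_le_stonerFactor ha.1 ha.2
  have hSab : 1 / (1 - a) ≤ 1 / (1 - b) := one_div_le_one_div_of_le (by linarith [hb.2]) (by linarith)
  have hloga : 0 ≤ Real.log (1 / (1 - a)) := Real.log_nonneg hSa
  have hlogab : Real.log (1 / (1 - a)) ≤ Real.log (1 / (1 - b)) :=
    Real.log_le_log (lt_of_lt_of_le zero_lt_one hSa) hSab
  have hlogb : 0 ≤ Real.log (1 / (1 - b)) := le_trans hloga hlogab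
  calc α * a * Real.log (1 / (1 - a)) ≤ α * b * Real.log (1 / (1 - a)) := by
        exact mul_le_mul_of_nonneg_right (mul_le_mul_of_nonneg_left hab hα) hloga
    _ ≤ α * b * Real.log (1 / (1 - b)) := by
        exact mul_le_mul_of_nonneg_left hlogab (mul_nonneg hα hb.1)

/-- The **characteristic paramagnon frequency** `ω_sf ≈ c · (1 − N(0)I)/(N(0)I) · p_F v_F` (`c ≈ 0.8`;
`p_F v_F ≈ 2 E_F`), «which should vanish near the magnetic phase transition»; as a function of the prefactor
`c`, the Stoner product `x` and the electronic scale `pv = p_F v_F`. [cite: BoseEtAl2003, Eq. (11)] -/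
def omegaSF (c x pv : ℝ) : ℝ := c * ((1 - x) / x) * pv

/-- `ω_sf` vanishes at the Stoner instability `x = 1`. [cite: BoseEtAl2003, Eq. (11)] -/
theorem omegaSF_one (c pv : ℝ) : omegaSF c 1 pv = 0 := by
  simp [omegaSF]

/-- `ω_sf ≥ 0` on `0 < x ≤ 1` for `c, p_F v_F ≥ 0`. [cite: BoseEtAl2003, Eq. (11)] -/
theorem omegaSF_nonneg {c x pv : ℝ} (hc : 0 ≤ c) (hx0 : 0 < x) (hx : x ≤ 1) (hpv : 0 ≤ pv) :
    0 ≤ omegaSF c x pv := by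
  unfold omegaSF
  have : 0 ≤ (1 - x) / x := div_nonneg (by linarith) hx0.le
  exact mul_nonneg (mul_nonneg hc this) hpv

/-- `ω_sf` is antitone in the Stoner product on `(0, 1]` (for `c, p_F v_F ≥ 0`): the paramagnon softens as the
instability is approached. [cite: BoseEtAl2003, Eq. (11)] -/
theorem omegaSF_antitoneOn {c pv : ℝ} (hc : 0 ≤ c) (hpv : 0 ≤ pv) :
    AntitoneOn (fun x => omegaSF c x pv) (Set.Ioc 0 1) := by
  intro a ha b hb hab
  simp only [Set.mem_Ioc] at ha hb
  unfold omegaSF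
  have hfrac : (1 - b) / b ≤ (1 - a) / a := by
    rw [div_le_div_iff₀ hb.1 ha.1]
    nlinarith [ha.1, hb.1]
  exact mul_le_mul_of_nonneg_right (mul_le_mul_of_nonneg_left hfrac hc) hpv

/-! ## The Daams–Mitrović–Carbotte rescaling -/

/-- The **effective electron–phonon coupling in the presence of paramagnons**, `λ_e = λ_ph / (1 + λ_S)`
(the whole Eliashberg function is rescaled, `α²F_e = α²F_ph/(1 + λ_S)`), where `λ_S = 2∫p(ω)ω⁻¹dω` is the
paramagnon spectral weight. [cite: Wolf1985, §4.5.3 Eq. (4.39)] [cite: DaamsMitrovicCarbotte1981, abstract] -/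
def dmcLambda (lam lamS : ℝ) : ℝ := lam / (1 + lamS)

/-- The **effective Coulomb pseudopotential in the presence of paramagnons**,
`μ*_e ≃ (μ*_ph + λ_S) / (1 + λ_S)`. [cite: Wolf1985, §4.5.3 Eq. (4.40)] [cite: DaamsMitrovicCarbotte1981, abstract] -/
def dmcMuStar (mu lamS : ℝ) : ℝ := (mu + lamS) / (1 + lamS)

/-- Without paramagnons the coupling is unchanged: `λ_e(λ, 0) = λ`. [cite: Wolf1985, §4.5.3 Eq. (4.39)] -/
theorem dmcLambda_zero (lam : ℝ) : dmcLambda lam 0 = lam := by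
  simp [dmcLambda]

/-- Without paramagnons the pseudopotential is unchanged: `μ*_e(μ*, 0) = μ*`. [cite: Wolf1985, §4.5.3 Eq. (4.40)] -/
theorem dmcMuStar_zero (mu : ℝ) : dmcMuStar mu 0 = mu := by
  simp [dmcMuStar]

/-- **Numerator identity** `1 + λ_e = (1 + λ + λ_S)/(1 + λ_S)`: the mass renormalisation in the rescaled
problem is the familiar `1 + λ_ph + λ_S`. [cite: Wolf1985, §4.5.3 Eq. (4.39)] -/
theorem one_add_dmcLambda {lam lamS : ℝ} (hS : -1 < lamS) :
    1 + dmcLambda lam lamS = (1 + lam + lamS) / (1 + lamS) := by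
  unfold dmcLambda
  have h1 : 1 + lamS ≠ 0 := by linarith
  field_simp
  ring

/-- **Denominator identity** `λ_e − μ*_e = (λ − μ* − λ_S)/(1 + λ_S)`: in the rescaled problem the net attraction
is the familiar `λ_ph − μ* − λ_S` — the paramagnons enter the BCS-type exponent as an added repulsion.
[cite: Wolf1985, §4.5.3 Eqs. (4.39)–(4.40)] -/
theorem dmcLambda_sub_dmcMuStar {lam mu lamS : ℝ} (hS : -1 < lamS) :
    dmcLambda lam lamS - dmcMuStar mu lamS = (lam - mu - lamS) / (1 + lamS) := by
  unfold dmcLambda dmcMuStar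
  have h1 : 1 + lamS ≠ 0 := by linarith
  field_simp
  ring

/-- **The effective BCS-type exponent**: `(1 + λ_e)/(λ_e − μ*_e) = (1 + λ + λ_S)/(λ − μ* − λ_S)` — the form in
which the rescaling is usually quoted. [cite: Wolf1985, §4.5.3 Eqs. (4.39)–(4.40)] -/
theorem dmc_effective_ratio {lam mu lamS : ℝ} (hS : -1 < lamS) (hD : lam - mu - lamS ≠ 0) :
    (1 + dmcLambda lam lamS) / (dmcLambda lam lamS - dmcMuStar mu lamS)
      = (1 + lam + lamS) / (lam - mu - lamS) := by
  rw [one_add_dmcLambda hS, dmcLambda_sub_dmcMuStar hS]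
  have h1 : (1 + lamS) ≠ 0 := by linarith
  field_simp

/-- `λ_e ≤ λ` for `λ ≥ 0`, `λ_S ≥ 0`: paramagnons weaken the effective phonon coupling.
[cite: Wolf1985, §4.5.3 Eq. (4.39)] -/
theorem dmcLambda_le {lam lamS : ℝ} (hlam : 0 ≤ lam) (hS : 0 ≤ lamS) : dmcLambda lam lamS ≤ lam := by
  unfold dmcLambda
  rw [div_le_iff₀ (by linarith)]
  nlinarith

/-- `λ_e < λ` for `λ > 0`, `λ_S > 0`. [cite: Wolf1985, §4.5.3 Eq. (4.39)] -/
theorem dmcLambda_lt {lam lamS : ℝ} (hlam : 0 < lam) (hS : 0 < lamS) : dmcLambda lam lamS < lam := by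
  unfold dmcLambda
  rw [div_lt_iff₀ (by linarith)]
  nlinarith

/-- `λ_e ≥ 0` for `λ ≥ 0`, `λ_S > −1`. [cite: Wolf1985, §4.5.3 Eq. (4.39)] -/
theorem dmcLambda_nonneg {lam lamS : ℝ} (hlam : 0 ≤ lam) (hS : -1 < lamS) : 0 ≤ dmcLambda lam lamS := by
  unfold dmcLambda
  exact div_nonneg hlam (by linarith)

/-- `λ_e` is monotone in the bare coupling `λ`. [cite: Wolf1985, §4.5.3 Eq. (4.39)] -/
theorem dmcLambda_mono_lam {l₁ l₂ lamS : ℝ} (hS : -1 < lamS) (h : l₁ ≤ l₂) :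
    dmcLambda l₁ lamS ≤ dmcLambda l₂ lamS := by
  unfold dmcLambda
  exact div_le_div_of_nonneg_right h (by linarith)

/-- `λ_e` is antitone in the paramagnon weight `λ_S` (for `λ ≥ 0`, on `λ_S > −1`).
[cite: Wolf1985, §4.5.3 Eq. (4.39)] -/
theorem dmcLambda_anti_lamS {lam s₁ s₂ : ℝ} (hlam : 0 ≤ lam) (hs₁ : -1 < s₁) (h : s₁ ≤ s₂) :
    dmcLambda lam s₂ ≤ dmcLambda lam s₁ := by
  unfold dmcLambda
  exact div_le_div_of_nonneg_left hlam (by linarith) (by linarith)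

/-- `1 − μ*_e = (1 − μ*)/(1 + λ_S)`: the rescaled pseudopotential approaches `1` from below as `λ_S` grows.
[cite: Wolf1985, §4.5.3 Eq. (4.40)] -/
theorem one_sub_dmcMuStar {mu lamS : ℝ} (hS : -1 < lamS) :
    1 - dmcMuStar mu lamS = (1 - mu) / (1 + lamS) := by
  unfold dmcMuStar
  have h1 : 1 + lamS ≠ 0 := by linarith
  field_simp
  ring

/-- `μ* ≤ μ*_e` for `μ* ≤ 1`, `λ_S ≥ 0`: paramagnons act as added Coulomb repulsion.
[cite: Wolf1985, §4.5.3 Eq. (4.40)] -/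
theorem le_dmcMuStar {mu lamS : ℝ} (hmu : mu ≤ 1) (hS : 0 ≤ lamS) : mu ≤ dmcMuStar mu lamS := by
  unfold dmcMuStar
  rw [le_div_iff₀ (by linarith)]
  nlinarith

/-- `μ*_e < 1` whenever `μ* < 1` (`λ_S > −1`): the rescaled pseudopotential stays a pseudopotential.
[cite: Wolf1985, §4.5.3 Eq. (4.40)] -/
theorem dmcMuStar_lt_one {mu lamS : ℝ} (hmu : mu < 1) (hS : -1 < lamS) : dmcMuStar mu lamS < 1 := by
  have h := one_sub_dmcMuStar (mu := mu) hS
  have : 0 < (1 - mu) / (1 + lamS) := div_pos (by linarith) (by linarith)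
  linarith

/-- `0 ≤ μ*_e` for `μ* ≥ 0`, `λ_S ≥ 0`. [cite: Wolf1985, §4.5.3 Eq. (4.40)] -/
theorem dmcMuStar_nonneg {mu lamS : ℝ} (hmu : 0 ≤ mu) (hS : 0 ≤ lamS) : 0 ≤ dmcMuStar mu lamS := by
  unfold dmcMuStar
  positivity

/-- `μ*_e` is monotone in the bare pseudopotential `μ*`. [cite: Wolf1985, §4.5.3 Eq. (4.40)] -/
theorem dmcMuStar_mono_mu {m₁ m₂ lamS : ℝ} (hS : -1 < lamS) (h : m₁ ≤ m₂) :
    dmcMuStar m₁ lamS ≤ dmcMuStar m₂ lamS := by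
  unfold dmcMuStar
  exact div_le_div_of_nonneg_right (by linarith) (by linarith)

/-- `μ*_e` is monotone in the paramagnon weight `λ_S` (for `μ* ≤ 1`, on `λ_S > −1`).
[cite: Wolf1985, §4.5.3 Eq. (4.40)] -/
theorem dmcMuStar_mono_lamS {mu s₁ s₂ : ℝ} (hmu : mu ≤ 1) (hs₁ : -1 < s₁) (h : s₁ ≤ s₂) :
    dmcMuStar mu s₁ ≤ dmcMuStar mu s₂ := by
  unfold dmcMuStar
  rw [div_le_div_iff₀ (by linarith) (by linarith)]
  nlinarith [mul_nonneg (sub_nonneg.2 hmu) (sub_nonneg.2 h)]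

/-- **The McMillan denominator at the rescaled pair, exactly**:
`λ_e − μ*_e (1 + 0.62 λ_e) = [λ − (μ* + λ_S)(1 + 0.62 λ/(1 + λ_S))] / (1 + λ_S)`.
[cite: Wolf1985, §4.5.3 Eqs. (4.39)–(4.40)] [cite: AllenDynes1975, Eq. (34)] -/
theorem mcMillanDenom_dmc {lam mu lamS : ℝ} (hS : -1 < lamS) :
    mcMillanDenom (dmcLambda lam lamS) (dmcMuStar mu lamS)
      = (lam - (mu + lamS) * (1 + 0.62 * lam / (1 + lamS))) / (1 + lamS) := by
  unfold mcMillanDenom dmcLambda dmcMuStar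
  have h1 : 1 + lamS ≠ 0 := by linarith
  field_simp

/-- **The McMillan exponent at the rescaled pair, exactly**:
`1.04 (1 + λ_e)/(λ_e − μ*_e(1 + 0.62 λ_e)) = 1.04 (1 + λ + λ_S) / [λ − (μ* + λ_S)(1 + 0.62 λ/(1 + λ_S))]`.
[cite: Wolf1985, §4.5.3 Eqs. (4.39)–(4.40)] [cite: AllenDynes1975, Eq. (34)] -/
theorem mcMillanExponent_dmc {lam mu lamS : ℝ} (hS : -1 < lamS) :
    mcMillanExponent (dmcLambda lam lamS) (dmcMuStar mu lamS)
      = 1.04 * (1 + lam + lamS) / (lam - (mu + lamS) * (1 + 0.62 * lam / (1 + lamS))) := by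
  unfold mcMillanExponent
  rw [mcMillanDenom_dmc hS, one_add_dmcLambda hS]
  have h1 : (1 + lamS) ≠ 0 := by linarith
  rw [mul_div_assoc, div_div_div_cancel_right₀ h1, ← mul_div_assoc]

/-- **The McMillan `T_c` with the Daams–Mitrović–Carbotte rescaling**: McMillan's formula (Allen–Dynes
normalisation) evaluated at `(λ_e, μ*_e) = (λ/(1 + λ_S), (μ* + λ_S)/(1 + λ_S))`.
[cite: Wolf1985, §4.5.3 Eqs. (4.39)–(4.40)] [cite: AllenDynes1975, Eq. (34)] -/
def dmcTc (omega lam mu lamS : ℝ) : ℝ :=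
  mcMillanTc omega (dmcLambda lam lamS) (dmcMuStar mu lamS)

/-- `dmcTc` reduces to McMillan's `T_c` without paramagnons. [cite: Wolf1985, §4.5.3 Eqs. (4.39)–(4.40)] -/
theorem dmcTc_zero (omega lam mu : ℝ) : dmcTc omega lam mu 0 = mcMillanTc omega lam mu := by
  simp [dmcTc, dmcLambda_zero, dmcMuStar_zero]

/-- `dmcTc ≥ 0` for `ω ≥ 0`. [cite: AllenDynes1975, Eq. (34)] -/
theorem dmcTc_nonneg {omega : ℝ} (lam mu lamS : ℝ) (hω : 0 ≤ omega) : 0 ≤ dmcTc omega lam mu lamS :=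
  mcMillanTc_nonneg _ _ hω

/-- **Paramagnons only lower the McMillan `T_c` (DMC convention)**: for `λ_S ≥ 0` on the physical domain
(`0 ≤ ω`, `0 ≤ λ`, `0 ≤ μ* ≤ 1`, McMillan denominator positive at the rescaled pair),
`dmcTc ω λ μ* λ_S ≤ mcMillanTc ω λ μ*` — composition of `λ_e ≤ λ`, `μ* ≤ μ*_e` with the monotonicity of the
McMillan form in `λ` and `μ*`. [cite: Wolf1985, §4.5.3 Eqs. (4.39)–(4.40)] [cite: AllenDynes1975, Eq. (34)] -/
theorem dmcTc_le_mcMillanTc {omega lam mu lamS : ℝ} (hω : 0 ≤ omega) (hlam : 0 ≤ lam) (hmu : 0 ≤ mu)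
    (hmu1 : mu ≤ 1) (hS : 0 ≤ lamS)
    (hD : 0 < mcMillanDenom (dmcLambda lam lamS) (dmcMuStar mu lamS)) :
    dmcTc omega lam mu lamS ≤ mcMillanTc omega lam mu := by
  have hS' : -1 < lamS := by linarith
  have hmue0 : 0 ≤ dmcMuStar mu lamS := dmcMuStar_nonneg hmu hS
  have hmue1 : dmcMuStar mu lamS ≤ 1 := by
    have := one_sub_dmcMuStar (mu := mu) hS'
    have : 0 ≤ (1 - mu) / (1 + lamS) := div_nonneg (by linarith) (by linarith)
    linarith
  have hmue' : 0.62 * dmcMuStar mu lamS ≤ 1 := by nlinarith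
  have hle : dmcLambda lam lamS ≤ lam := dmcLambda_le hlam hS
  have hD2 : 0 < mcMillanDenom lam (dmcMuStar mu lamS) :=
    lt_of_lt_of_le hD (mcMillanDenom_mono_lam hmue' hle)
  unfold dmcTc
  calc mcMillanTc omega (dmcLambda lam lamS) (dmcMuStar mu lamS)
      ≤ mcMillanTc omega lam (dmcMuStar mu lamS) := mcMillanTc_mono_lam hω hmue0 hmue' hD hle
    _ ≤ mcMillanTc omega lam mu := mcMillanTc_anti_mu hω hlam (le_dmcMuStar hmu1 hS) hD2

/-- **`dmcTc` is antitone in the paramagnon weight**: for `0 ≤ λ_S₁ ≤ λ_S₂` on the physical domain (McMillan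
denominator positive at the MORE suppressed point) `dmcTc(λ_S₂) ≤ dmcTc(λ_S₁)`.
[cite: Wolf1985, §4.5.3 Eqs. (4.39)–(4.40)] [cite: AllenDynes1975, Eq. (34)] -/
theorem dmcTc_anti_lamS {omega lam mu s₁ s₂ : ℝ} (hω : 0 ≤ omega) (hlam : 0 ≤ lam) (hmu : 0 ≤ mu)
    (hmu1 : mu ≤ 1) (hs₁ : 0 ≤ s₁) (h : s₁ ≤ s₂)
    (hD : 0 < mcMillanDenom (dmcLambda lam s₂) (dmcMuStar mu s₂)) :
    dmcTc omega lam mu s₂ ≤ dmcTc omega lam mu s₁ := by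
  have hs₁' : -1 < s₁ := by linarith
  have hs₂ : 0 ≤ s₂ := le_trans hs₁ h
  have hs₂' : -1 < s₂ := by linarith
  have hmue0 : 0 ≤ dmcMuStar mu s₂ := dmcMuStar_nonneg hmu hs₂
  have hmue1 : dmcMuStar mu s₂ ≤ 1 := by
    have := one_sub_dmcMuStar (mu := mu) hs₂'
    have : 0 ≤ (1 - mu) / (1 + s₂) := div_nonneg (by linarith) (by linarith)
    linarith
  have hmue' : 0.62 * dmcMuStar mu s₂ ≤ 1 := by nlinarith
  have hle : dmcLambda lam s₂ ≤ dmcLambda lam s₁ := dmcLambda_anti_lamS hlam hs₁' h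
  have hD2 : 0 < mcMillanDenom (dmcLambda lam s₁) (dmcMuStar mu s₂) :=
    lt_of_lt_of_le hD (mcMillanDenom_mono_lam hmue' hle)
  have hlame0 : 0 ≤ dmcLambda lam s₁ := dmcLambda_nonneg hlam hs₁'
  unfold dmcTc
  calc mcMillanTc omega (dmcLambda lam s₂) (dmcMuStar mu s₂)
      ≤ mcMillanTc omega (dmcLambda lam s₁) (dmcMuStar mu s₂) := mcMillanTc_mono_lam hω hmue0 hmue' hD hle
    _ ≤ mcMillanTc omega (dmcLambda lam s₁) (dmcMuStar mu s₁) :=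
        mcMillanTc_anti_mu hω hlame0 (dmcMuStar_mono_lamS hmu1 hs₁' h) hD2

/-! ## The extended McMillan formula with paramagnons -/

/-- The denominator `λ_ph − λ_sf − μ*[1 + 0.62 (λ_ph + λ_sf)]` of the extended McMillan exponent; the formula
is meaningful only where it is positive. [cite: BoseEtAl2003, Eq. (12)] -/
def sfDenom (lam mu lamS : ℝ) : ℝ := lam - lamS - mu * (1 + 0.62 * (lam + lamS))

/-- The extended McMillan exponent `1.04 (1 + λ_ph + λ_sf) / (λ_ph − λ_sf − μ*[1 + 0.62 (λ_ph + λ_sf)])`.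
[cite: BoseEtAl2003, Eq. (12)] -/
def sfExponent (lam mu lamS : ℝ) : ℝ := 1.04 * (1 + lam + lamS) / sfDenom lam mu lamS

/-- **The extended McMillan formula with paramagnons** (valid for a paramagnon spectrum concentrated at
`ω_sf ≫ ω_ph`): `T_c = (ω_ln^{ph}/1.2) · exp{−1.04 (1 + λ_ph + λ_sf)/(λ_ph − λ_sf − μ*[1 + 0.62(λ_ph + λ_sf)])}`.
[cite: BoseEtAl2003, Eq. (12)] -/
def sfTc (omega lam mu lamS : ℝ) : ℝ := omega / 1.2 * Real.exp (-sfExponent lam mu lamS)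

/-- The extended denominator as an affine function of `λ_sf`: `sfDenom = mcMillanDenom λ μ* − (1 + 0.62 μ*) λ_sf`.
[cite: BoseEtAl2003, Eq. (12)] [cite: Mcmillan1968, Eq. (18)] -/
theorem sfDenom_eq (lam mu lamS : ℝ) :
    sfDenom lam mu lamS = mcMillanDenom lam mu - (1 + 0.62 * mu) * lamS := by
  unfold sfDenom mcMillanDenom
  ring

/-- Without paramagnons the extended denominator is McMillan's. [cite: BoseEtAl2003, Eq. (12)] -/
theorem sfDenom_zero (lam mu : ℝ) : sfDenom lam mu 0 = mcMillanDenom lam mu := by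
  rw [sfDenom_eq]; ring

/-- Without paramagnons the extended exponent is McMillan's. [cite: BoseEtAl2003, Eq. (12)] -/
theorem sfExponent_zero (lam mu : ℝ) : sfExponent lam mu 0 = mcMillanExponent lam mu := by
  unfold sfExponent mcMillanExponent
  rw [sfDenom_zero]; ring_nf

/-- **Reduction**: without paramagnons the extended formula is McMillan's `T_c`. [cite: BoseEtAl2003, Eq. (12)] -/
theorem sfTc_zero (omega lam mu : ℝ) : sfTc omega lam mu 0 = mcMillanTc omega lam mu := by
  unfold sfTc mcMillanTc
  rw [sfExponent_zero]

/-- `T_c ≥ 0` whenever the phonon scale is `≥ 0`. [cite: BoseEtAl2003, Eq. (12)] -/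
theorem sfTc_nonneg {omega : ℝ} (lam mu lamS : ℝ) (hω : 0 ≤ omega) : 0 ≤ sfTc omega lam mu lamS := by
  unfold sfTc; positivity

/-- `T_c > 0` whenever the phonon scale is `> 0` (the formula never vanishes on its domain).
[cite: BoseEtAl2003, Eq. (12)] -/
theorem sfTc_pos {omega : ℝ} (lam mu lamS : ℝ) (hω : 0 < omega) : 0 < sfTc omega lam mu lamS := by
  unfold sfTc; positivity

/-- `T_c` is monotone (linear) in the phonon scale. [cite: BoseEtAl2003, Eq. (12)] -/
theorem sfTc_mono_omega {ω₁ ω₂ : ℝ} (lam mu lamS : ℝ) (h : ω₁ ≤ ω₂) :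
    sfTc ω₁ lam mu lamS ≤ sfTc ω₂ lam mu lamS := by
  unfold sfTc
  have hexp : 0 < Real.exp (-sfExponent lam mu lamS) := Real.exp_pos _
  have : ω₁ / 1.2 ≤ ω₂ / 1.2 := div_le_div_of_nonneg_right h (by norm_num)
  exact mul_le_mul_of_nonneg_right this hexp.le

/-- The extended denominator is antitone in `λ_sf` for `μ* ≥ 0` (slope `−(1 + 0.62 μ*)`).
[cite: BoseEtAl2003, Eq. (12)] -/
theorem sfDenom_anti_lamS {lam mu s₁ s₂ : ℝ} (hmu : 0 ≤ mu) (h : s₁ ≤ s₂) :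
    sfDenom lam mu s₂ ≤ sfDenom lam mu s₁ := by
  rw [sfDenom_eq, sfDenom_eq]
  nlinarith [mul_nonneg hmu (sub_nonneg.2 h)]

/-- The extended denominator is strictly antitone in `λ_sf` for `μ* ≥ 0`. [cite: BoseEtAl2003, Eq. (12)] -/
theorem sfDenom_strictAnti_lamS {lam mu s₁ s₂ : ℝ} (hmu : 0 ≤ mu) (h : s₁ < s₂) :
    sfDenom lam mu s₂ < sfDenom lam mu s₁ := by
  rw [sfDenom_eq, sfDenom_eq]
  nlinarith [mul_nonneg hmu (sub_nonneg.2 h.le)]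

/-- The extended denominator is monotone in `λ_ph` for `0.62 μ* ≤ 1`. [cite: BoseEtAl2003, Eq. (12)] -/
theorem sfDenom_mono_lam {mu lamS l₁ l₂ : ℝ} (hmu' : 0.62 * mu ≤ 1) (h : l₁ ≤ l₂) :
    sfDenom l₁ mu lamS ≤ sfDenom l₂ mu lamS := by
  unfold sfDenom
  nlinarith [mul_nonneg (sub_nonneg.2 hmu') (sub_nonneg.2 h)]

/-- The extended denominator is antitone in `μ*` for `λ_ph + λ_sf ≥ 0` (indeed for `1 + 0.62(λ_ph + λ_sf) ≥ 0`).
[cite: BoseEtAl2003, Eq. (12)] -/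
theorem sfDenom_anti_mu {lam lamS m₁ m₂ : ℝ} (hls : 0 ≤ lam + lamS) (h : m₁ ≤ m₂) :
    sfDenom lam m₂ lamS ≤ sfDenom lam m₁ lamS := by
  unfold sfDenom
  nlinarith [mul_nonneg (sub_nonneg.2 h) hls]

/-- **The extended exponent is monotone in `λ_sf`** on the physical domain (`0 ≤ λ_ph`, `0 ≤ μ*`, `0 ≤ λ_sf₁`,
denominator positive at the larger `λ_sf`): the numerator `1 + λ_ph + λ_sf` grows and the denominator shrinks.
[cite: BoseEtAl2003, Eq. (12)] -/
theorem sfExponent_mono_lamS {lam mu s₁ s₂ : ℝ} (hlam : 0 ≤ lam) (hmu : 0 ≤ mu) (hs₁ : 0 ≤ s₁)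
    (h : s₁ ≤ s₂) (hD : 0 < sfDenom lam mu s₂) :
    sfExponent lam mu s₁ ≤ sfExponent lam mu s₂ := by
  have hD₁ : 0 < sfDenom lam mu s₁ := lt_of_lt_of_le hD (sfDenom_anti_lamS hmu h)
  unfold sfExponent
  rw [div_le_div_iff₀ hD₁ hD]
  have hnum : 0 ≤ 1.04 * (1 + lam + s₁) := by positivity
  have hnum' : 1.04 * (1 + lam + s₁) ≤ 1.04 * (1 + lam + s₂) := by nlinarith
  calc 1.04 * (1 + lam + s₁) * sfDenom lam mu s₂
      ≤ 1.04 * (1 + lam + s₁) * sfDenom lam mu s₁ :=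
        mul_le_mul_of_nonneg_left (sfDenom_anti_lamS hmu h) hnum
    _ ≤ 1.04 * (1 + lam + s₂) * sfDenom lam mu s₁ := mul_le_mul_of_nonneg_right hnum' hD₁.le

/-- **The extended exponent is strictly monotone in `λ_sf`** on the physical domain. [cite: BoseEtAl2003, Eq. (12)] -/
theorem sfExponent_strictMono_lamS {lam mu s₁ s₂ : ℝ} (hlam : 0 ≤ lam) (hmu : 0 ≤ mu) (hs₁ : 0 ≤ s₁)
    (h : s₁ < s₂) (hD : 0 < sfDenom lam mu s₂) :
    sfExponent lam mu s₁ < sfExponent lam mu s₂ := by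
  have hD₁ : 0 < sfDenom lam mu s₁ := lt_trans hD (sfDenom_strictAnti_lamS hmu h)
  unfold sfExponent
  rw [div_lt_div_iff₀ hD₁ hD]
  have hnum : 0 < 1.04 * (1 + lam + s₁) := by positivity
  have hnum' : 1.04 * (1 + lam + s₁) ≤ 1.04 * (1 + lam + s₂) := by nlinarith
  calc 1.04 * (1 + lam + s₁) * sfDenom lam mu s₂
      < 1.04 * (1 + lam + s₁) * sfDenom lam mu s₁ :=
        mul_lt_mul_of_pos_left (sfDenom_strictAnti_lamS hmu h) hnum
    _ ≤ 1.04 * (1 + lam + s₂) * sfDenom lam mu s₁ := mul_le_mul_of_nonneg_right hnum' hD₁.le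

/-- **The extended exponent is antitone in `λ_ph`** on the physical domain (`0 ≤ μ*`, `0.62 μ* ≤ 1`,
`0 ≤ λ_sf`, denominator positive at the smaller `λ_ph`): the computation is
`(1+λ₂+s)D(λ₁) − (1+λ₁+s)D(λ₂) = −(λ₂ − λ₁)[(1 − 0.62μ*)(1 + s) + s + μ* + 0.62 μ* s] ≤ 0`.
[cite: BoseEtAl2003, Eq. (12)] -/
theorem sfExponent_anti_lam {mu lamS l₁ l₂ : ℝ} (hmu : 0 ≤ mu) (hmu' : 0.62 * mu ≤ 1) (hs : 0 ≤ lamS)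
    (hD : 0 < sfDenom l₁ mu lamS) (h : l₁ ≤ l₂) :
    sfExponent l₂ mu lamS ≤ sfExponent l₁ mu lamS := by
  have hD₂ : 0 < sfDenom l₂ mu lamS := lt_of_lt_of_le hD (sfDenom_mono_lam hmu' h)
  unfold sfExponent
  rw [div_le_div_iff₀ hD₂ hD]
  unfold sfDenom
  nlinarith [mul_nonneg (sub_nonneg.2 hmu') (sub_nonneg.2 h), mul_nonneg hmu (sub_nonneg.2 h),
    mul_nonneg hs (sub_nonneg.2 h), mul_nonneg (mul_nonneg hmu hs) (sub_nonneg.2 h)]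

/-- **The extended exponent is monotone in `μ*`** on the physical domain (`0 ≤ λ_ph + λ_sf`,
`0 ≤ 1 + λ_ph + λ_sf`, denominator positive at the larger `μ*`). [cite: BoseEtAl2003, Eq. (12)] -/
theorem sfExponent_mono_mu {lam lamS m₁ m₂ : ℝ} (hls : 0 ≤ lam + lamS) (h : m₁ ≤ m₂)
    (hD : 0 < sfDenom lam m₂ lamS) :
    sfExponent lam m₁ lamS ≤ sfExponent lam m₂ lamS := by
  have hD₁ : 0 < sfDenom lam m₁ lamS := lt_of_lt_of_le hD (sfDenom_anti_mu hls h)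
  unfold sfExponent
  rw [div_le_div_iff₀ hD₁ hD]
  have hnum : 0 ≤ 1.04 * (1 + lam + lamS) := by nlinarith
  exact mul_le_mul_of_nonneg_left (sfDenom_anti_mu hls h) hnum

/-- **Paramagnons lower `T_c` (extended McMillan form)**: `T_c` is antitone in `λ_sf` on the physical domain.
[cite: BoseEtAl2003, Eq. (12)] -/
theorem sfTc_anti_lamS {omega lam mu s₁ s₂ : ℝ} (hω : 0 ≤ omega) (hlam : 0 ≤ lam) (hmu : 0 ≤ mu)
    (hs₁ : 0 ≤ s₁) (h : s₁ ≤ s₂) (hD : 0 < sfDenom lam mu s₂) :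
    sfTc omega lam mu s₂ ≤ sfTc omega lam mu s₁ := by
  unfold sfTc
  have hg := sfExponent_mono_lamS hlam hmu hs₁ h hD
  have hexp : Real.exp (-sfExponent lam mu s₂) ≤ Real.exp (-sfExponent lam mu s₁) :=
    Real.exp_le_exp.2 (by linarith)
  exact mul_le_mul_of_nonneg_left hexp (by positivity)

/-- **Strict suppression**: for `ω > 0`, `T_c` is STRICTLY antitone in `λ_sf` on the physical domain.
[cite: BoseEtAl2003, Eq. (12)] -/
theorem sfTc_strictAnti_lamS {omega lam mu s₁ s₂ : ℝ} (hω : 0 < omega) (hlam : 0 ≤ lam) (hmu : 0 ≤ mu)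
    (hs₁ : 0 ≤ s₁) (h : s₁ < s₂) (hD : 0 < sfDenom lam mu s₂) :
    sfTc omega lam mu s₂ < sfTc omega lam mu s₁ := by
  unfold sfTc
  have hg := sfExponent_strictMono_lamS hlam hmu hs₁ h hD
  have hexp : Real.exp (-sfExponent lam mu s₂) < Real.exp (-sfExponent lam mu s₁) :=
    Real.exp_lt_exp.2 (by linarith)
  exact mul_lt_mul_of_pos_left hexp (by positivity)

/-- `T_c` (extended form) is monotone increasing in `λ_ph` on the physical domain. [cite: BoseEtAl2003, Eq. (12)] -/
theorem sfTc_mono_lam {omega mu lamS l₁ l₂ : ℝ} (hω : 0 ≤ omega) (hmu : 0 ≤ mu) (hmu' : 0.62 * mu ≤ 1)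
    (hs : 0 ≤ lamS) (hD : 0 < sfDenom l₁ mu lamS) (h : l₁ ≤ l₂) :
    sfTc omega l₁ mu lamS ≤ sfTc omega l₂ mu lamS := by
  unfold sfTc
  have hg := sfExponent_anti_lam hmu hmu' hs hD h
  have hexp : Real.exp (-sfExponent l₁ mu lamS) ≤ Real.exp (-sfExponent l₂ mu lamS) :=
    Real.exp_le_exp.2 (by linarith)
  exact mul_le_mul_of_nonneg_left hexp (by positivity)

/-- `T_c` (extended form) is monotone decreasing in `μ*` on the physical domain. [cite: BoseEtAl2003, Eq. (12)] -/
theorem sfTc_anti_mu {omega lam lamS m₁ m₂ : ℝ} (hω : 0 ≤ omega) (hls : 0 ≤ lam + lamS) (h : m₁ ≤ m₂)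
    (hD : 0 < sfDenom lam m₂ lamS) :
    sfTc omega lam m₂ lamS ≤ sfTc omega lam m₁ lamS := by
  unfold sfTc
  have hg := sfExponent_mono_mu hls h hD
  have hexp : Real.exp (-sfExponent lam m₂ lamS) ≤ Real.exp (-sfExponent lam m₁ lamS) :=
    Real.exp_le_exp.2 (by linarith)
  exact mul_le_mul_of_nonneg_left hexp (by positivity)

/-- **`sfTc ≤ mcMillanTc`**: with `λ_sf ≥ 0` the extended formula never exceeds the phonon-only McMillan
value (physical domain, denominator positive at `λ_sf`). [cite: BoseEtAl2003, Eq. (12)] [cite: AllenDynes1975, Eq. (34)] -/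
theorem sfTc_le_mcMillanTc {omega lam mu lamS : ℝ} (hω : 0 ≤ omega) (hlam : 0 ≤ lam) (hmu : 0 ≤ mu)
    (hs : 0 ≤ lamS) (hD : 0 < sfDenom lam mu lamS) :
    sfTc omega lam mu lamS ≤ mcMillanTc omega lam mu := by
  rw [← sfTc_zero]
  exact sfTc_anti_lamS hω hlam hmu (le_refl 0) hs hD

/-- **Box → band (extended McMillan form).** If `(ω, λ_ph, μ*, λ_sf)` ranges over a box
`[ω₋, ω₊] × [λ₋, λ₊] × [μ₋, μ₊] × [s₋, s₊]` inside the physical domain (`0 ≤ ω₋`, `0 ≤ λ₋`, `0 ≤ μ₋`,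
`0.62 μ₊ ≤ 1`, `0 ≤ s₋`, and the denominator is positive at the worst corner `(λ₋, μ₊, s₊)`), then `T_c` lies
between its value at the corner `(ω₋, λ₋, μ₊, s₊)` and its value at `(ω₊, λ₊, μ₋, s₋)`.
[cite: BoseEtAl2003, Eq. (12)] -/
theorem sfTc_mem_Icc_of_mem_box {ωlo ωhi llo lhi mlo mhi slo shi ω lam mu s : ℝ}
    (hωlo : 0 ≤ ωlo) (hllo : 0 ≤ llo) (hmlo : 0 ≤ mlo) (hmhi : 0.62 * mhi ≤ 1) (hslo : 0 ≤ slo)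
    (hD : 0 < sfDenom llo mhi shi)
    (hω : ω ∈ Set.Icc ωlo ωhi) (hl : lam ∈ Set.Icc llo lhi) (hm : mu ∈ Set.Icc mlo mhi)
    (hs : s ∈ Set.Icc slo shi) :
    sfTc ω lam mu s ∈ Set.Icc (sfTc ωlo llo mhi shi) (sfTc ωhi lhi mlo slo) := by
  obtain ⟨hω₁, hω₂⟩ := hω
  obtain ⟨hl₁, hl₂⟩ := hl
  obtain ⟨hm₁, hm₂⟩ := hm
  obtain ⟨hs₁, hs₂⟩ := hs
  have hmu0 : 0 ≤ mu := le_trans hmlo hm₁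
  have hmhi0 : 0 ≤ mhi := le_trans hmu0 hm₂
  have hmu' : 0.62 * mu ≤ 1 := by nlinarith
  have hmlo' : 0.62 * mlo ≤ 1 := by nlinarith
  have hlam0 : 0 ≤ lam := le_trans hllo hl₁
  have hs0 : 0 ≤ s := le_trans hslo hs₁
  have hωhi : 0 ≤ ωhi := le_trans hωlo (le_trans hω₁ hω₂)
  -- denominators along the chain, each obtained from the previous by a monotone step
  have hD1 : 0 < sfDenom llo mhi s := lt_of_lt_of_le hD (sfDenom_anti_lamS hmhi0 hs₂)
  have hD2 : 0 < sfDenom llo mu s := lt_of_lt_of_le hD1 (sfDenom_anti_mu (by linarith) hm₂)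
  have hD3 : 0 < sfDenom lam mu s := lt_of_lt_of_le hD2 (sfDenom_mono_lam hmu' hl₁)
  have hD4 : 0 < sfDenom lhi mu s := lt_of_lt_of_le hD3 (sfDenom_mono_lam hmu' hl₂)
  have hD5 : 0 < sfDenom lhi mlo s := lt_of_lt_of_le hD4 (sfDenom_anti_mu (by linarith) hm₁)
  constructor
  · calc sfTc ωlo llo mhi shi ≤ sfTc ωlo llo mhi s := sfTc_anti_lamS hωlo hllo hmhi0 hs0 hs₂ hD
      _ ≤ sfTc ωlo llo mu s := sfTc_anti_mu hωlo (by linarith) hm₂ hD1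
      _ ≤ sfTc ωlo lam mu s := sfTc_mono_lam hωlo hmu0 hmu' hs0 hD2 hl₁
      _ ≤ sfTc ω lam mu s := sfTc_mono_omega lam mu s hω₁
  · calc sfTc ω lam mu s ≤ sfTc ωhi lam mu s := sfTc_mono_omega lam mu s hω₂
      _ ≤ sfTc ωhi lhi mu s := sfTc_mono_lam hωhi hmu0 hmu' hs0 hD3 hl₂
      _ ≤ sfTc ωhi lhi mlo s := sfTc_anti_mu hωhi (by linarith) hm₁ hD4
      _ ≤ sfTc ωhi lhi mlo slo := sfTc_anti_lamS hωhi (le_trans hlam0 hl₂) hmlo hslo hs₁ hD5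

/-! ## Ordering of the two printed conventions -/

/-- **The two conventions differ by an explicit term**: with `d_B = sfDenom λ μ* λ_S` (extended McMillan) and
`d_D = (1 + λ_S)·mcMillanDenom(λ_e, μ*_e)` (the DMC-rescaled McMillan denominator, which carries the SAME
numerator `1.04(1 + λ + λ_S)` by `mcMillanExponent_dmc`),
`d_D − d_B = 0.62 λ_S [μ*(1 + λ + λ_S) − λ] / (1 + λ_S)`.
[cite: Wolf1985, §4.5.3 Eqs. (4.39)–(4.40)] [cite: BoseEtAl2003, Eq. (12)] -/
theorem dmcDenom_sub_sfDenom {lam mu lamS : ℝ} (hS : -1 < lamS) :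
    (lam - (mu + lamS) * (1 + 0.62 * lam / (1 + lamS))) - sfDenom lam mu lamS
      = 0.62 * lamS * (mu * (1 + lam + lamS) - lam) / (1 + lamS) := by
  unfold sfDenom
  have h1 : 1 + lamS ≠ 0 := by linarith
  field_simp
  ring

/-- In the regime `μ*(1 + λ + λ_S) ≤ λ` (every case with an appreciable phonon `T_c`: e.g. `μ* = 0.13` needs
only `λ ≥ 0.15 (1 + λ_S)`), the DMC-rescaled McMillan denominator is the SMALLER one:
`λ − (μ* + λ_S)(1 + 0.62 λ/(1 + λ_S)) ≤ sfDenom λ μ* λ_S` (`λ_S ≥ 0`).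
[cite: Wolf1985, §4.5.3 Eqs. (4.39)–(4.40)] [cite: BoseEtAl2003, Eq. (12)] -/
theorem dmcDenom_le_sfDenom {lam mu lamS : ℝ} (hS : 0 ≤ lamS) (hreg : mu * (1 + lam + lamS) ≤ lam) :
    lam - (mu + lamS) * (1 + 0.62 * lam / (1 + lamS)) ≤ sfDenom lam mu lamS := by
  have hS' : -1 < lamS := by linarith
  have h := dmcDenom_sub_sfDenom (lam := lam) (mu := mu) hS'
  have hnum : 0.62 * lamS * (mu * (1 + lam + lamS) - lam) ≤ 0 := by
    have : 0 ≤ 0.62 * lamS := by positivity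
    nlinarith
  have : 0.62 * lamS * (mu * (1 + lam + lamS) - lam) / (1 + lamS) ≤ 0 :=
    div_nonpos_of_nonpos_of_nonneg hnum (by linarith)
  linarith

/-- **`dmcTc ≤ sfTc`: the DMC rescaling suppresses MORE than the extended McMillan formula** at equal
`(ω, λ, μ*, λ_S)`, in the regime `μ*(1 + λ + λ_S) ≤ λ` and on the physical domain (`0 ≤ ω`, `0 ≤ λ`,
`0 ≤ λ_S`, DMC denominator positive). Together with `sfTc_le_mcMillanTc`:
`dmcTc ≤ sfTc ≤ mcMillanTc` — the two printed conventions bracket, they are never averaged.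
[cite: Wolf1985, §4.5.3 Eqs. (4.39)–(4.40)] [cite: BoseEtAl2003, Eq. (12)] -/
theorem dmcTc_le_sfTc {omega lam mu lamS : ℝ} (hω : 0 ≤ omega) (hlam : 0 ≤ lam)
    (hS : 0 ≤ lamS) (hreg : mu * (1 + lam + lamS) ≤ lam)
    (hD : 0 < mcMillanDenom (dmcLambda lam lamS) (dmcMuStar mu lamS)) :
    dmcTc omega lam mu lamS ≤ sfTc omega lam mu lamS := by
  have hS' : -1 < lamS := by linarith
  have h2 : 0 < 1 + lamS := by linarith
  -- the DMC denominator in the un-normalised form is positive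
  have hdD_pos : 0 < lam - (mu + lamS) * (1 + 0.62 * lam / (1 + lamS)) := by
    have h1 := mcMillanDenom_dmc (lam := lam) (mu := mu) hS'
    rw [h1] at hD
    exact (div_pos_iff_of_pos_right h2).1 hD
  have hdB_pos : 0 < sfDenom lam mu lamS := lt_of_lt_of_le hdD_pos (dmcDenom_le_sfDenom hS hreg)
  -- compare exponents: same numerator, smaller denominator ⇒ larger exponent
  have hnum : 0 ≤ 1.04 * (1 + lam + lamS) := by positivity
  have hexp_le : sfExponent lam mu lamS ≤ mcMillanExponent (dmcLambda lam lamS) (dmcMuStar mu lamS) := by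
    rw [mcMillanExponent_dmc hS']
    unfold sfExponent
    exact div_le_div_of_nonneg_left hnum hdD_pos (dmcDenom_le_sfDenom hS hreg)
  unfold dmcTc sfTc mcMillanTc
  have hexp : Real.exp (-mcMillanExponent (dmcLambda lam lamS) (dmcMuStar mu lamS))
      ≤ Real.exp (-sfExponent lam mu lamS) := Real.exp_le_exp.2 (by linarith)
  exact mul_le_mul_of_nonneg_left hexp (by positivity)

/-! ## Fitting `λ_sf` to a measured `T_c`: uniqueness and existence -/

/-- The physical `λ_sf`-domain at fixed `(λ, μ*)`: nonnegative paramagnon coupling with positive extended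
denominator. [cite: BoseEtAl2003, Eq. (12)] -/
def sfDomain (lam mu : ℝ) : Set ℝ := {s | 0 ≤ s ∧ 0 < sfDenom lam mu s}

/-- **Uniqueness of the fitted `λ_sf`**: at fixed `(ω, λ, μ*)` with `ω > 0`, `λ ≥ 0`, `μ* ≥ 0` the map
`λ_sf ↦ T_c` is injective on the physical domain — two different paramagnon couplings never reproduce the same
`T_c`. [cite: BoseEtAl2003, Eq. (12)] -/
theorem sfTc_injOn {omega lam mu : ℝ} (hω : 0 < omega) (hlam : 0 ≤ lam) (hmu : 0 ≤ mu) :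
    Set.InjOn (fun s => sfTc omega lam mu s) (sfDomain lam mu) := by
  have hanti : StrictAntiOn (fun s => sfTc omega lam mu s) (sfDomain lam mu) := by
    intro a ha b hb hab
    exact sfTc_strictAnti_lamS hω hlam hmu ha.1 hab hb.2
  exact hanti.injOn

/-- The critical paramagnon coupling `λ_sf^* = mcMillanDenom λ μ* / (1 + 0.62 μ*)` at which the extended
denominator vanishes (`T_c → 0⁺`): `sfDenom λ μ* s = (1 + 0.62 μ*)(λ_sf^* − s)`.
[cite: BoseEtAl2003, Eq. (12)] -/
def lamSFCrit (lam mu : ℝ) : ℝ := mcMillanDenom lam mu / (1 + 0.62 * mu)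

/-- `sfDenom λ μ* s = (1 + 0.62 μ*)·(λ_sf^* − s)` for `μ* ≥ 0`. [cite: BoseEtAl2003, Eq. (12)] -/
theorem sfDenom_eq_mul_crit_sub {lam mu : ℝ} (hmu : 0 ≤ mu) (s : ℝ) :
    sfDenom lam mu s = (1 + 0.62 * mu) * (lamSFCrit lam mu - s) := by
  unfold lamSFCrit
  rw [sfDenom_eq]
  have h1 : (1 + 0.62 * mu) ≠ 0 := by positivity
  field_simp

/-- The physical `λ_sf`-domain is the interval `[0, λ_sf^*)` (`μ* ≥ 0`). [cite: BoseEtAl2003, Eq. (12)] -/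
theorem mem_sfDomain_iff {lam mu s : ℝ} (hmu : 0 ≤ mu) :
    s ∈ sfDomain lam mu ↔ 0 ≤ s ∧ s < lamSFCrit lam mu := by
  unfold sfDomain
  simp only [Set.mem_setOf_eq]
  rw [sfDenom_eq_mul_crit_sub hmu]
  have hc : 0 < 1 + 0.62 * mu := by positivity
  constructor
  · rintro ⟨h0, hD⟩
    refine ⟨h0, ?_⟩
    by_contra hle
    rw [not_lt] at hle
    have : (1 + 0.62 * mu) * (lamSFCrit lam mu - s) ≤ 0 :=
      mul_nonpos_of_nonneg_of_nonpos hc.le (by linarith)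
    linarith
  · rintro ⟨h0, hlt⟩
    exact ⟨h0, mul_pos hc (by linarith)⟩

/-- Continuity of `λ_sf ↦ T_c` on any interval `[0, s₁]` on which the extended denominator stays positive.
[cite: BoseEtAl2003, Eq. (12)] -/
theorem sfTc_continuousOn_Icc {omega lam mu s₁ : ℝ} (hmu : 0 ≤ mu) (hD : 0 < sfDenom lam mu s₁) :
    ContinuousOn (fun s => sfTc omega lam mu s) (Set.Icc 0 s₁) := by
  have hden : ∀ s ∈ Set.Icc (0:ℝ) s₁, sfDenom lam mu s ≠ 0 := by
    intro s hs
    exact (lt_of_lt_of_le hD (sfDenom_anti_lamS hmu hs.2)).ne'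
  unfold sfTc sfExponent sfDenom
  apply ContinuousOn.mul continuousOn_const
  apply ContinuousOn.rexp
  apply ContinuousOn.neg
  apply ContinuousOn.div
  · exact (continuousOn_const.mul ((continuousOn_const.add continuousOn_id)))
  · exact ((continuousOn_const.sub continuousOn_id).sub
      (continuousOn_const.mul (continuousOn_const.add
        (continuousOn_const.mul (continuousOn_const.add continuousOn_id)))))
  · intro s hs
    exact hden s hs

/-- **Existence of the fitted `λ_sf`** (intermediate value theorem): at fixed `(ω, λ, μ*)` in the physical
domain (`0 < ω`, `0 ≤ λ`, `0 ≤ μ*`, McMillan denominator positive) EVERY temperature `T` with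
`0 < T ≤ T_c^{McM}(ω, λ, μ*)` is attained by the extended formula at some `λ_sf` in the physical domain:
a measured `T_c` below the phonon-only value determines a paramagnon coupling (unique by `sfTc_injOn`).
[cite: BoseEtAl2003, Eq. (12)] -/
theorem exists_lamSF_sfTc_eq {omega lam mu T : ℝ} (hω : 0 < omega) (hlam : 0 ≤ lam) (hmu : 0 ≤ mu)
    (hD : 0 < mcMillanDenom lam mu) (hT : 0 < T) (hTle : T ≤ mcMillanTc omega lam mu) :
    ∃ s ∈ sfDomain lam mu, sfTc omega lam mu s = T := by
  -- constants
  set c := 1 + 0.62 * mu with hc_def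
  have hc : 0 < c := by positivity
  set d0 := mcMillanDenom lam mu with hd0_def
  set L := Real.log (omega / (1.2 * T)) with hL_def
  set M := max L 1 with hM_def
  have hM1 : 1 ≤ M := le_max_right _ _
  have hMpos : 0 < M := lt_of_lt_of_le zero_lt_one hM1
  -- the target value δ of the denominator at the right end of the bracketing interval
  set δ := min d0 (1.04 / M) with hδ_def
  have hδpos : 0 < δ := lt_min hD (div_pos (by norm_num) hMpos)
  have hδd0 : δ ≤ d0 := min_le_left _ _
  have hδM : δ ≤ 1.04 / M := min_le_right _ _
  -- the right end s₁ with sfDenom = δ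
  set s₁ := (d0 - δ) / c with hs₁_def
  have hs₁0 : 0 ≤ s₁ := div_nonneg (by linarith) hc.le
  have hden₁ : sfDenom lam mu s₁ = δ := by
    rw [sfDenom_eq, ← hd0_def, ← hc_def, hs₁_def]
    field_simp
    ring
  have hD₁ : 0 < sfDenom lam mu s₁ := by rw [hden₁]; exact hδpos
  -- value at the right end is ≤ T
  have hright : sfTc omega lam mu s₁ ≤ T := by
    -- exponent at s₁ is ≥ M ≥ L
    have hE : M ≤ sfExponent lam mu s₁ := by
      unfold sfExponent
      rw [hden₁, le_div_iff₀ hδpos]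
      have h1 : M * δ ≤ 1.04 := by
        calc M * δ ≤ M * (1.04 / M) := mul_le_mul_of_nonneg_left hδM hMpos.le
          _ = 1.04 := by field_simp
      have h2 : (1.04:ℝ) ≤ 1.04 * (1 + lam + s₁) := by nlinarith
      linarith
    have hEL : L ≤ sfExponent lam mu s₁ := le_trans (le_max_left _ _) hE
    -- exp(−E) ≤ exp(−L) = 1.2 T / ω
    have hωT : 0 < omega / (1.2 * T) := by positivity
    have hexp : Real.exp (-sfExponent lam mu s₁) ≤ 1.2 * T / omega := by
      calc Real.exp (-sfExponent lam mu s₁) ≤ Real.exp (-L) := Real.exp_le_exp.2 (by linarith)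
        _ = 1.2 * T / omega := by
          rw [hL_def, Real.exp_neg, Real.exp_log hωT]
          field_simp
    unfold sfTc
    calc omega / 1.2 * Real.exp (-sfExponent lam mu s₁)
        ≤ omega / 1.2 * (1.2 * T / omega) := mul_le_mul_of_nonneg_left hexp (by positivity)
      _ = T := by field_simp
  -- value at the left end is ≥ T
  have hleft : T ≤ sfTc omega lam mu 0 := by rw [sfTc_zero]; exact hTle
  -- intermediate value theorem on [0, s₁]
  have hcont := sfTc_continuousOn_Icc (omega := omega) hmu hD₁
  have hmem : T ∈ Set.Icc (sfTc omega lam mu s₁) (sfTc omega lam mu 0) := ⟨hright, hleft⟩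
  obtain ⟨s, hs, hsT⟩ := intermediate_value_Icc' hs₁0 hcont hmem
  refine ⟨s, ⟨hs.1, ?_⟩, hsT⟩
  exact lt_of_lt_of_le hD₁ (sfDenom_anti_lamS hmu hs.2)


/-! ## `DFT+U` as an effective Stoner renormalisation

Petukhov–Mazin–Chioncel–Lichtenstein (2003): to first approximation a `+U` correction (SIC flavour) acts on
the magnetic instability of a metal like a renormalised Stoner parameter `I_eff = I₀ + (U − J)/n`, `n` the
number of (degenerate) orbitals at the Fermi level; Smolyanyuk et al. (2024, §II.B) use exactly this to read
the `DFT+U` onset of the compensated moment in RuO₂. Below `Ueff` stands for the printed `U − J`. -/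

/-- The effective Stoner parameter of a `+U`-corrected functional, `I_eff = I₀ + U_eff/n` (`U_eff = U − J`,
`n` orbitals at the Fermi level). [cite: SmolyanyukEtAl2024, §II.B (text before Fig. 6, after PetukhovEtAl2003)] -/
def stonerIeff (I0 Ueff n : ℝ) : ℝ := I0 + Ueff / n

/-- The `+U` at which the renormalised Stoner product reaches one: `U_crit = n (1/D − I₀)` for a density of
states `D` (per spin, per orbital set as the source uses it). [cite: SmolyanyukEtAl2024, §II.B (derived from
`D · I_eff = 1`)] -/
def stonerUcrit (D I0 n : ℝ) : ℝ := n * (1 / D - I0)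

/-- At `U_eff = 0` the Stoner parameter is the bare DFT one. [cite: SmolyanyukEtAl2024, §II.B] -/
theorem stonerIeff_zero (I0 n : ℝ) : stonerIeff I0 0 n = I0 := by
  unfold stonerIeff; simp

/-- The renormalised Stoner product, expanded: `D · I_eff = D I₀ + D U_eff / n`. [cite: SmolyanyukEtAl2024, §II.B] -/
theorem mul_stonerIeff_eq (D I0 Ueff n : ℝ) : D * stonerIeff I0 Ueff n = D * I0 + D * Ueff / n := by
  unfold stonerIeff; ring

/-- `I_eff` is strictly increasing in `U_eff` (for `n > 0`). [cite: SmolyanyukEtAl2024, §II.B] -/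
theorem stonerIeff_lt_stonerIeff {I0 n U₁ U₂ : ℝ} (hn : 0 < n) (h : U₁ < U₂) :
    stonerIeff I0 U₁ n < stonerIeff I0 U₂ n := by
  unfold stonerIeff
  have := div_lt_div_of_pos_right h hn
  linarith

/-- `I_eff` is monotone in `U_eff` (for `n > 0`). [cite: SmolyanyukEtAl2024, §II.B] -/
theorem stonerIeff_le_stonerIeff {I0 n U₁ U₂ : ℝ} (hn : 0 < n) (h : U₁ ≤ U₂) :
    stonerIeff I0 U₁ n ≤ stonerIeff I0 U₂ n := by
  unfold stonerIeff
  have := div_le_div_of_nonneg_right h hn.le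
  linarith

/-- At fixed `U_eff > 0`, sharing the correction among MORE orbitals weakens it: `I_eff` is strictly
decreasing in `n > 0`. [cite: SmolyanyukEtAl2024, §II.B («for n = 2 it is just a bit below instability»)] -/
theorem stonerIeff_anti_n {I0 Ueff n₁ n₂ : ℝ} (hU : 0 < Ueff) (hn₁ : 0 < n₁) (h : n₁ < n₂) :
    stonerIeff I0 Ueff n₂ < stonerIeff I0 Ueff n₁ := by
  unfold stonerIeff
  have := div_lt_div_of_pos_left hU hn₁ h
  linarith

/-- The signed distance to the instability: `D · I_eff − 1 = (D/n) (U_eff − U_crit)` (for `D, n ≠ 0`).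
[cite: SmolyanyukEtAl2024, §II.B; PetukhovEtAl2003] -/
theorem mul_stonerIeff_sub_one {D I0 Ueff n : ℝ} (hD : D ≠ 0) (hn : n ≠ 0) :
    D * stonerIeff I0 Ueff n - 1 = (D / n) * (Ueff - stonerUcrit D I0 n) := by
  unfold stonerIeff stonerUcrit
  field_simp
  ring

/-- **The renormalised Stoner criterion as a threshold in `U_eff`**: for `D > 0`, `n > 0`,
`1 < D · I_eff ⇔ U_crit < U_eff` with `U_crit = n (1/D − I₀)`. [cite: SmolyanyukEtAl2024, §II.B; PetukhovEtAl2003] -/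
theorem one_lt_mul_stonerIeff_iff {D I0 Ueff n : ℝ} (hD : 0 < D) (hn : 0 < n) :
    1 < D * stonerIeff I0 Ueff n ↔ stonerUcrit D I0 n < Ueff := by
  have hc : 0 < D / n := div_pos hD hn
  have key := mul_stonerIeff_sub_one (I0 := I0) (Ueff := Ueff) hD.ne' hn.ne'
  constructor
  · intro h
    by_contra hle
    push Not at hle
    have : D / n * (Ueff - stonerUcrit D I0 n) ≤ 0 :=
      mul_nonpos_of_nonneg_of_nonpos hc.le (sub_nonpos.mpr hle)
    linarith
  · intro h
    have : 0 < D / n * (Ueff - stonerUcrit D I0 n) := mul_pos hc (sub_pos.mpr h)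
    linarith

/-- The sub-critical side: `D · I_eff < 1 ⇔ U_eff < U_crit`. [cite: SmolyanyukEtAl2024, §II.B; PetukhovEtAl2003] -/
theorem mul_stonerIeff_lt_one_iff {D I0 Ueff n : ℝ} (hD : 0 < D) (hn : 0 < n) :
    D * stonerIeff I0 Ueff n < 1 ↔ Ueff < stonerUcrit D I0 n := by
  have hc : 0 < D / n := div_pos hD hn
  have key := mul_stonerIeff_sub_one (I0 := I0) (Ueff := Ueff) hD.ne' hn.ne'
  constructor
  · intro h
    by_contra hle
    push Not at hle
    have : 0 ≤ D / n * (Ueff - stonerUcrit D I0 n) := mul_nonneg hc.le (sub_nonneg.mpr hle)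
    linarith
  · intro h
    have : D / n * (Ueff - stonerUcrit D I0 n) < 0 := mul_neg_of_pos_of_neg hc (sub_neg.mpr h)
    linarith

/-- A metal that is Stoner-STABLE without the correction (`D I₀ < 1`) needs a strictly POSITIVE `U_eff` to
order: `0 < U_crit ⇔ D I₀ < 1` (for `D, n > 0`). [cite: SmolyanyukEtAl2024, §II.B («D↑(E_F)·I₀ = 0.35 < 1, so the
material is stable against the formation of a ferromagnetic state»)] -/
theorem stonerUcrit_pos_iff {D I0 n : ℝ} (hD : 0 < D) (hn : 0 < n) :
    0 < stonerUcrit D I0 n ↔ D * I0 < 1 := by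
  unfold stonerUcrit
  rw [mul_pos_iff_of_pos_left hn, sub_pos, lt_div_iff₀ hD]
  constructor <;> intro h <;> linarith

/-- `U_crit` grows linearly with the number of orbitals sharing the correction (when `D I₀ < 1`).
[cite: SmolyanyukEtAl2024, §II.B] -/
theorem stonerUcrit_lt_stonerUcrit {D I0 n₁ n₂ : ℝ} (hD : 0 < D) (hx : D * I0 < 1) (h : n₁ < n₂) :
    stonerUcrit D I0 n₁ < stonerUcrit D I0 n₂ := by
  unfold stonerUcrit
  have : 0 < 1 / D - I0 := by
    rw [sub_pos, lt_div_iff₀ hD]; linarith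
  nlinarith

/-- Below the instability the Stoner enhancement factor of the `+U`-corrected metal INCREASES with `U_eff`
(composition with `stonerFactor`'s monotonicity on `x < 1`). [cite: SmolyanyukEtAl2024, §II.B; Wolf1985, §4.5.3 Eq. (4.36)] -/
theorem stonerFactor_stonerIeff_lt {D I0 n U₁ U₂ : ℝ} (hD : 0 < D) (hn : 0 < n) (h : U₁ < U₂)
    (h2 : D * stonerIeff I0 U₂ n < 1) :
    stonerFactor (D * stonerIeff I0 U₁ n) < stonerFactor (D * stonerIeff I0 U₂ n) := by
  have hlt : D * stonerIeff I0 U₁ n < D * stonerIeff I0 U₂ n :=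
    mul_lt_mul_of_pos_left (stonerIeff_lt_stonerIeff hn h) hD
  exact stonerFactor_strictMonoOn (lt_trans hlt h2) h2 hlt

/-! ### The printed RuO₂ arithmetic (Smolyanyuk et al. 2024 §II.A–B) as decidable corollaries

Inputs as printed: `D↑(E_F) = 0.7` st/(eV·spin), `I₀ ∼ 0.5` eV (typical 4d value), `U_eff = 1.4` eV, `n = 1`
or `2`; `DFT+U` onset of the compensated moment `U_eff ∼ 1.06` eV (metastable) / `1.23` eV (ground state).
Nothing below is a statement about RuO₂ — only about these numbers. -/

/-- `D↑(E_F)·I₀ = 0.7 × 0.5 = 0.35 < 1`: Stoner-stable at `U = 0`. [cite: SmolyanyukEtAl2024, §II.B] -/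
theorem ruO2_bare_stoner_product : (7 / 10 : ℝ) * stonerIeff (1 / 2) 0 1 = 7 / 20 ∧ (7 / 20 : ℝ) < 1 := by
  unfold stonerIeff; constructor <;> norm_num

/-- `n = 1`, `U_eff = 1.4`: `I_eff = 1.9` eV and `D·I_eff = 1.33 > 1` («thus fulfilling the Stoner
criterion»). [cite: SmolyanyukEtAl2024, §II.B] -/
theorem ruO2_n1_Ueff14 :
    stonerIeff (1 / 2) (14 / 10) 1 = 19 / 10 ∧ (1 : ℝ) < 7 / 10 * stonerIeff (1 / 2) (14 / 10) 1 := by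
  unfold stonerIeff; constructor <;> norm_num

/-- `n = 2`, `U_eff = 1.4`: `I_eff = 1.2` eV and `D·I_eff = 0.84 < 1` («for n = 2 it is just a bit below
instability»). [cite: SmolyanyukEtAl2024, §II.B] -/
theorem ruO2_n2_Ueff14 :
    stonerIeff (1 / 2) (14 / 10) 2 = 12 / 10 ∧ (7 / 10 : ℝ) * stonerIeff (1 / 2) (14 / 10) 2 < 1 := by
  unfold stonerIeff; constructor <;> norm_num

/-- The two thresholds: `U_crit(n = 1) = 13/14 ≈ 0.93` eV and `U_crit(n = 2) = 13/7 ≈ 1.86` eV for `D = 0.7`,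
`I₀ = 0.5`. [cite: SmolyanyukEtAl2024, §II.B (derived)] -/
theorem ruO2_stonerUcrit :
    stonerUcrit (7 / 10) (1 / 2) 1 = 13 / 14 ∧ stonerUcrit (7 / 10) (1 / 2) 2 = 13 / 7 := by
  unfold stonerUcrit; constructor <;> norm_num

/-- The printed `DFT+U` onset window of the compensated RuO₂ moment, `U_eff ∈ [1.06, 1.23]` eV, lies strictly
BETWEEN the `n = 1` and `n = 2` effective-Stoner thresholds (`13/14 < 1.06` and `1.23 < 13/7`) — the exact
content of the source's «order-of-magnitude» reconciliation. [cite: SmolyanyukEtAl2024, §II.A (onset) and §II.B] -/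
theorem ruO2_onset_between_thresholds :
    stonerUcrit (7 / 10) (1 / 2) 1 < (106 / 100 : ℝ) ∧ (123 / 100 : ℝ) < stonerUcrit (7 / 10) (1 / 2) 2 := by
  unfold stonerUcrit; constructor <;> norm_num

end Paramagnon

end Literature.MathematicalPhysics.QuantumManyBody
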